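import Mathlib.Probability.Kernel.MeasurableIntegral
import Literature.Probability.Distributions.JointLawTruncatedLimitGlue
import Literature.Probability.Percolation.Z2PivotalMeasureIntegral
import Literature.Probability.Percolation.QuadCrossingContinuityEventsDischarge
import Literature.Probability.Percolation.QuadCrossingNoiseDiscrete
import Literature.Probability.Percolation.QuadCrossingSpaceProofs
import HarnessLib

/-!
# Campbell functionals of the averaged pivotal measures of bond-`ℤ²` pass to the limit

Topic `Literature/Probability/Percolation`; proofs file next to `Z2PivotalMeasure.lean` /
`Z2PivotalMeasureIntegral.lean` (Garban–Pete–Schramm's isometry-averaged normalised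
`ε`-important measures `μ^ε_δ(ω) = z2PivotalMeasure ε δ ω` of bond percolation on `δℤ²`) and to the
model-free glue `Literature/Probability/Distributions/JointLawTruncatedLimitGlue.lean`.  No named
fact is introduced; everything is proved.

**Setting.**  A mesh sequence `δ_k → 0⁺` realising a subsequential quad-crossing limit `μ` on the
Schramm–Smirnov space `ℋ = QuadConfig univ`, a measurable kernel `M ε : ℋ → Measure ℂ`, and the
joint convergence in law of (configuration `ω_{δ_k} ∈ ℋ`, `⟨μ^ε_{δ_k}(ω), ψ⟩`) to
`(S, ⟨M ε S, ψ⟩)`, `S ∼ μ`, tested on bounded continuous functions — the convergence clause of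
`IsZ2PivotalKernelLimit`.

**Contents.**
* generic bookkeeping: `measurable_integral_of_measurable_measure` (`S ↦ ∫ f d(κ S)` is
  measurable for a measurable family of measures, from Mathlib's
  `StronglyMeasurable.integral_kernel`), `tendsto_pair_of_tendsto_fin_one` (test functions of
  `ℋ × ℝ¹` vs `ℋ × ℝ`), `ae_eq_sub_of_tendsto_triple` (**linear relations among the lattice
  functionals pass to the joint limit almost surely** — test against `min 1 |v₀ - v₁ + v₂|`);
* lattice side: `⟨μ^ε_δ(ω), ψ⟩` is bounded in `ω` for `ψ ∈ C_c(ℂ)`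
  (`exists_abs_integral_z2PivotalMeasure_le`), hence `P_½`-integrable together with its square and
  its products with bounded measurable factors;
* pattern atoms `{S | {i | Qᵢ ∈ S} = T}` of finitely many quads: finite intersections of crossing
  events and their complements (`setOf_pattern_eq_iInter`), hence Borel and — by Schramm–Smirnov
  2011 Lemma 5.1, proved in the tree (`SchrammSmirnov2011_lemma_5_1_holds`) — continuity sets of
  every subsequential limit (`measure_frontier_setOf_pattern_eq_zero`); the decomposition of a
  function of the pattern along the atoms and the resulting summation of limits
  (`tendsto_integral_mul_apply_pattern`);
* **`tendsto_integral_integral_mul_apply_pattern_of_nonneg`**: for `ψ ≥ 0` in `C_c(ℂ)` with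
  uniform second moments `sup_k E[⟨μ^ε_{δ_k}, ψ⟩²] < ∞`,
  `E[⟨μ^ε_{δ_k}, ψ⟩ g(pattern ω_{δ_k})] → ∫ ⟨M ε S, ψ⟩ g(pattern S) dμ(S)` for every cylinder datum
  `(Q, g)` — the glue `tendsto_integral_mul_indicator_of_tendsto_pair` on each atom, summed.

Written for the line `registered` of crux `FlipErgodicityZ2` (route
`Summits/CriticalPhenomena/CardyFormulaZ2/Theses/CardyMeckeFlip`), stub
`stub_patternCampbellLimit` (the left-hand side of the lattice Campbell–Mecke identity passes to
the limit), which adds only the splitting `φ = φ⁺ - φ⁻`.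

## References

* C. Garban, G. Pete, O. Schramm, JAMS 26 (2013), arXiv:1008.1378, §4 (the measures `μ^ε` and
  their limits); JEMS 20 (2018), arXiv:1305.5526, §2.6.
* O. Schramm, S. Smirnov, Ann. Probab. 39 (2011), Lemma 5.1 and Cor. 5.2 (continuity events).
* P. Billingsley, *Convergence of Probability Measures*, 2nd ed. (1999), Thm. 2.1, Thm. 3.5.
-/

noncomputable section

open Set Filter Metric
open _root_.MeasureTheory _root_.Topology
open scoped ENNReal

namespace Literature.Probability.Percolation

open QuadCrossing LatticeModels Literature.Probability.Distributions

/-! ### Generic weak-convergence bookkeeping -/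

/-- The integral of a fixed strongly measurable function against a measurable family of measures
is a measurable function of the parameter (Mathlib's `StronglyMeasurable.integral_kernel`, for the
kernel `⟨κ, hκ⟩`; no finiteness of the measures is needed). [folklore] -/
theorem measurable_integral_of_measurable_measure {E α : Type*} [MeasurableSpace E]
    [MeasurableSpace α] {κ : E → Measure α} (hκ : Measurable κ) {f : α → ℝ}
    (hf : StronglyMeasurable f) : Measurable fun S => ∫ x, f x ∂(κ S) :=
  (hf.integral_kernel (κ := ⟨κ, hκ⟩)).measurable

/-- Joint convergence tested on bounded continuous functions of `E × (Fin 1 → ℝ)` gives joint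
convergence tested on bounded continuous functions of `E × ℝ` (compose with `(S, v) ↦ (S, v 0)`).
[folklore] -/
theorem tendsto_pair_of_tendsto_fin_one {Ω E : Type*} [MeasurableSpace Ω] {P : Measure Ω}
    [TopologicalSpace E] [MeasurableSpace E] {μ : Measure E}
    {X : ℕ → Ω → E} {t : ℕ → Ω → ℝ} {tlim : E → ℝ}
    (h : ∀ G : BoundedContinuousFunction (E × (Fin 1 → ℝ)) ℝ,
      Tendsto (fun k => ∫ ω, G (X k ω, fun _ => t k ω) ∂P) atTop
        (𝓝 (∫ S, G (S, fun _ => tlim S) ∂μ)))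
    (F : BoundedContinuousFunction (E × ℝ) ℝ) :
    Tendsto (fun k => ∫ ω, F (X k ω, t k ω) ∂P) atTop (𝓝 (∫ S, F (S, tlim S) ∂μ)) := by
  have := h (F.compContinuous ⟨fun p => (p.1, p.2 0), by fun_prop⟩)
  simpa only [BoundedContinuousFunction.compContinuous_apply, ContinuousMap.coe_mk] using this

/-- **Linear relations pass to the joint limit almost surely.**  If `(X_k, v_k)` converges
jointly in law to `(S, w S)` (tested on bounded continuous functions of `E × ℝ³`) and the lattice
vectors satisfy `v_k⁰ = v_k¹ - v_k²` identically, then `w⁰ = w¹ - w²` `μ`-almost surely: test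
against the bounded continuous `min 1 |v⁰ - v¹ + v²|`, whose lattice integrals vanish.
[folklore] -/
theorem ae_eq_sub_of_tendsto_triple {Ω E : Type*} [MeasurableSpace Ω] {P : Measure Ω}
    [TopologicalSpace E] [MeasurableSpace E] [OpensMeasurableSpace E] {μ : Measure E}
    [IsFiniteMeasure μ] {X : ℕ → Ω → E} {v : ℕ → Ω → Fin 3 → ℝ} {w : E → Fin 3 → ℝ}
    (h : ∀ G : BoundedContinuousFunction (E × (Fin 3 → ℝ)) ℝ,
      Tendsto (fun k => ∫ ω, G (X k ω, v k ω) ∂P) atTop (𝓝 (∫ S, G (S, w S) ∂μ)))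
    (hv : ∀ k ω, v k ω 0 = v k ω 1 - v k ω 2) (hw : ∀ j, Measurable fun S => w S j) :
    ∀ᵐ S ∂μ, w S 0 = w S 1 - w S 2 := by
  set D : E × (Fin 3 → ℝ) → ℝ := fun p => min 1 |p.2 0 - p.2 1 + p.2 2| with hD
  have hDc : Continuous D := by fun_prop
  have hD0 : ∀ p, 0 ≤ D p := fun p => le_min zero_le_one (abs_nonneg _)
  have hD1 : ∀ p, ‖D p‖ ≤ 1 := fun p => by
    rw [Real.norm_eq_abs, abs_of_nonneg (hD0 p)]
    exact min_le_left _ _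
  set G : BoundedContinuousFunction (E × (Fin 3 → ℝ)) ℝ :=
    BoundedContinuousFunction.ofNormedAddCommGroup D hDc 1 hD1 with hG
  have hGD : ∀ p, G p = D p := fun p => rfl
  have hk : ∀ k, ∫ ω, G (X k ω, v k ω) ∂P = 0 := fun k => by
    have h0 : ∀ ω, G (X k ω, v k ω) = 0 := fun ω => by
      rw [hGD, hD]
      simp only [hv k ω, sub_sub_cancel_left, neg_add_cancel, abs_zero]
      exact min_eq_right zero_le_one
    simp only [h0, integral_zero]
  have hlim : ∫ S, G (S, w S) ∂μ = 0 := by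
    refine tendsto_nhds_unique (h G) ?_
    simp only [hk]
    exact tendsto_const_nhds
  have hwm : Measurable w := measurable_pi_iff.2 hw
  have hmeas : Measurable fun S => G (S, w S) :=
    G.continuous.measurable.comp (measurable_id.prodMk hwm)
  have hint : Integrable (fun S => G (S, w S)) μ :=
    Integrable.of_bound hmeas.aestronglyMeasurable 1 (ae_of_all _ fun S => hD1 _)
  have hae := (integral_eq_zero_iff_of_nonneg (fun S => hD0 _) hint).1 hlim
  filter_upwards [hae] with S hS
  have h1 : min 1 |w S 0 - w S 1 + w S 2| = 0 := hS
  have h2 : |w S 0 - w S 1 + w S 2| = 0 := by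
    rcases min_choice (1 : ℝ) |w S 0 - w S 1 + w S 2| with h | h
    · rw [h] at h1; exact absurd h1 one_ne_zero
    · rwa [h] at h1
  linarith [abs_eq_zero.1 h2]

/-! ### Lattice side: bounds and integrability of `ω ↦ ⟨μ^ε_δ(ω), ψ⟩` -/

/-- `⟨μ^ε_δ(ω), ψ⟩` is bounded uniformly in `ω` for `ψ ∈ C_c(ℂ)` (`δ > 0`): it is a finite sum of
weights `≤ r(δ)` times values of `ψ`. [folklore] -/
theorem exists_abs_integral_z2PivotalMeasure_le (ε : ℝ) {δ : ℝ} (hδ : 0 < δ) {ψ : ℂ → ℝ}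
    (hψ : Continuous ψ) (hψc : HasCompactSupport ψ) :
    ∃ B : ℝ, ∀ ω, |∫ x, ψ x ∂(z2PivotalMeasure ε δ ω)| ≤ B := by
  obtain ⟨E, hE⟩ := exists_finset_of_hasCompactSupport hδ hψc
  refine ⟨∑ p ∈ E, pivotalRate δ * |ψ (edgeMidpoint δ p.1 p.2)|, fun ω => ?_⟩
  rw [integral_z2PivotalMeasure_eq_sum ε hδ ω hψ hψc E hE]
  refine (Finset.abs_sum_le_sum_abs _ _).trans (Finset.sum_le_sum fun p _ => ?_)
  rw [abs_mul, abs_of_nonneg ENNReal.toReal_nonneg]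
  exact mul_le_mul_of_nonneg_right (pivotalWeight_toReal_le ε δ ω p.1 p.2) (abs_nonneg _)

/-- `ω ↦ ⟨μ^ε_δ(ω), ψ⟩` is `P_½`-integrable (bounded and measurable). [folklore] -/
theorem integrable_integral_z2PivotalMeasure {ε δ : ℝ} (hε : 0 < ε) (hδ : 0 < δ) {ψ : ℂ → ℝ}
    (hψ : Continuous ψ) (hψc : HasCompactSupport ψ) :
    Integrable (fun ω => ∫ x, ψ x ∂(z2PivotalMeasure ε δ ω)) (bondPercolation (zdGraph 2) half) := by
  haveI : IsProbabilityMeasure (bondPercolation (zdGraph 2) half) := by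
    unfold bondPercolation; infer_instance
  obtain ⟨B, hB⟩ := exists_abs_integral_z2PivotalMeasure_le ε hδ hψ hψc
  exact Integrable.of_bound
    (measurable_integral_z2PivotalMeasure hε hδ hψ hψc).aestronglyMeasurable B
    (ae_of_all _ fun ω => (Real.norm_eq_abs _).le.trans (hB ω))

/-- `ω ↦ ⟨μ^ε_δ(ω), ψ⟩ · G(ω)` is `P_½`-integrable for a bounded measurable `G`. [folklore] -/
theorem integrable_integral_z2PivotalMeasure_mul {ε δ : ℝ} (hε : 0 < ε) (hδ : 0 < δ)
    {ψ : ℂ → ℝ} (hψ : Continuous ψ) (hψc : HasCompactSupport ψ)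
    {G : BondConfig (Site 2) → ℝ} (hG : Measurable G) {C : ℝ} (hC : ∀ ω, |G ω| ≤ C) :
    Integrable (fun ω => (∫ x, ψ x ∂(z2PivotalMeasure ε δ ω)) * G ω)
      (bondPercolation (zdGraph 2) half) :=
  (integrable_integral_z2PivotalMeasure hε hδ hψ hψc).mul_bdd hG.aestronglyMeasurable
    (ae_of_all _ fun ω => (Real.norm_eq_abs _).le.trans (hC ω))

/-- `ω ↦ ⟨μ^ε_δ(ω), ψ⟩²` is `P_½`-integrable. [folklore] -/
theorem integrable_sq_integral_z2PivotalMeasure {ε δ : ℝ} (hε : 0 < ε) (hδ : 0 < δ)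
    {ψ : ℂ → ℝ} (hψ : Continuous ψ) (hψc : HasCompactSupport ψ) :
    Integrable (fun ω => (∫ x, ψ x ∂(z2PivotalMeasure ε δ ω)) ^ 2)
      (bondPercolation (zdGraph 2) half) := by
  obtain ⟨B, hB⟩ := exists_abs_integral_z2PivotalMeasure_le ε hδ hψ hψc
  simpa only [sq] using integrable_integral_z2PivotalMeasure_mul hε hδ hψ hψc
    (measurable_integral_z2PivotalMeasure hε hδ hψ hψc) hB

/-! ### Pattern atoms `{S | {i | Qᵢ ∈ S} = T}` -/

/-- A pattern atom is a finite intersection of crossing events and complements of crossing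
events. [folklore] -/
theorem setOf_pattern_eq_iInter {n : ℕ} (Q : Fin n → Quad (univ : Set ℂ)) (T : Set (Fin n))
    [DecidablePred (· ∈ T)] :
    {S : QuadConfig (univ : Set ℂ) | {i | Q i ∈ S} = T} =
      ⋂ i ∈ (Finset.univ : Finset (Fin n)), if decide (i ∈ T) then QuadConfig.crossedEvent (Q i)
        else (QuadConfig.crossedEvent (Q i))ᶜ := by
  ext S
  simp only [mem_setOf_eq, mem_iInter, Finset.mem_univ, true_imp_iff, Set.ext_iff]
  refine forall_congr' fun i => ?_
  by_cases hi : i ∈ T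
  · simp only [hi, iff_true, decide_true, if_true, QuadConfig.mem_crossedEvent]
  · simp only [hi, iff_false, decide_false, Bool.false_eq_true, if_false, mem_compl_iff,
      QuadConfig.mem_crossedEvent]

/-- Pattern atoms are Borel. [folklore] -/
theorem measurableSet_setOf_pattern_eq {n : ℕ} (Q : Fin n → Quad (univ : Set ℂ))
    (T : Set (Fin n)) : MeasurableSet {S : QuadConfig (univ : Set ℂ) | {i | Q i ∈ S} = T} := by
  classical
  rw [setOf_pattern_eq_iInter Q T]
  refine Finset.univ.measurableSet_biInter fun i _ => ?_
  split_ifs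
  · exact QuadConfig.measurableSet_crossedEvent (Q i)
  · exact (QuadConfig.measurableSet_crossedEvent (Q i)).compl

/-- **Pattern atoms are continuity sets of every subsequential limit** (Schramm–Smirnov 2011,
Lemma 5.1 / Cor. 5.2, proved in the tree). [folklore] -/
theorem measure_frontier_setOf_pattern_eq_zero {μ : FiniteMeasure (QuadConfig (univ : Set ℂ))}
    (hμ : IsSubseqQuadLimit univ μ) {n : ℕ} (Q : Fin n → Quad (univ : Set ℂ)) (T : Set (Fin n)) :
    (μ : Measure (QuadConfig (univ : Set ℂ))) (frontier {S | {i | Q i ∈ S} = T}) = 0 := by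
  classical
  rw [setOf_pattern_eq_iInter Q T]
  exact SchrammSmirnov2011_lemma_5_1_holds.measure_frontier_cylinderAtom_eq_zero isOpen_univ
    univ_nonempty hμ Finset.univ Q fun i => decide (i ∈ T)

/-- Decomposition of a function of the pattern along the atoms:
`a · g(pattern x) = Σ_T g(T) · (a · 1{pattern x = T})`. [folklore] -/
theorem mul_apply_pattern_eq_sum {n : ℕ} (Q : Fin n → Quad (univ : Set ℂ)) (g : Set (Fin n) → ℝ)
    (a : ℝ) (x : QuadConfig (univ : Set ℂ)) :
    a * g {i | Q i ∈ x} = ∑ T : Set (Fin n),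
      g T * (a * {S : QuadConfig (univ : Set ℂ) | {i | Q i ∈ S} = T}.indicator 1 x) := by
  rw [Finset.sum_eq_single_of_mem {i | Q i ∈ x} (Finset.mem_univ _) fun T _ hT => ?_]
  · have hx : x ∈ {S : QuadConfig (univ : Set ℂ) | {i | Q i ∈ S} = {i | Q i ∈ x}} := rfl
    rw [indicator_of_mem hx, Pi.one_apply, mul_one, mul_comm]
  · have hx : x ∉ {S : QuadConfig (univ : Set ℂ) | {i | Q i ∈ S} = T} := fun h => hT h.symm
    rw [indicator_of_notMem hx, mul_zero, mul_zero]

/-- A function of the pattern is a measurable function on `ℋ`. [folklore] -/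
theorem measurable_apply_pattern {n : ℕ} (Q : Fin n → Quad (univ : Set ℂ))
    {β : Type*} [MeasurableSpace β] (g : Set (Fin n) → β) :
    Measurable fun S : QuadConfig (univ : Set ℂ) => g {i | Q i ∈ S} := by
  have hpat : Measurable fun S : QuadConfig (univ : Set ℂ) => {i | Q i ∈ S} :=
    measurable_set_iff.2 fun i => measurableSet_setOf.1 (QuadConfig.measurableSet_crossedEvent (Q i))
  exact (measurable_of_countable g).comp hpat

/-- **Summing the atoms**: if `E[t_k 1_T(X_k)] → ∫ tlim 1_T dμ` for every pattern atom `T`, then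
`E[t_k g(pattern X_k)] → ∫ tlim g(pattern) dμ`. [folklore] -/
theorem tendsto_integral_mul_apply_pattern {Ω : Type*} [MeasurableSpace Ω] {P : Measure Ω}
    {μ : Measure (QuadConfig (univ : Set ℂ))} {X : ℕ → Ω → QuadConfig (univ : Set ℂ)}
    {t : ℕ → Ω → ℝ} {tlim : QuadConfig (univ : Set ℂ) → ℝ}
    {n : ℕ} (Q : Fin n → Quad (univ : Set ℂ)) (g : Set (Fin n) → ℝ)
    (hatom : ∀ T : Set (Fin n), Tendsto
      (fun k => ∫ ω, t k ω * {S : QuadConfig (univ : Set ℂ) | {i | Q i ∈ S} = T}.indicator 1 (X k ω) ∂P)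
      atTop (𝓝 (∫ S, tlim S * {S' : QuadConfig (univ : Set ℂ) | {i | Q i ∈ S'} = T}.indicator 1 S ∂μ)))
    (hint : ∀ k (T : Set (Fin n)), Integrable
      (fun ω => t k ω * {S : QuadConfig (univ : Set ℂ) | {i | Q i ∈ S} = T}.indicator 1 (X k ω)) P)
    (hintlim : ∀ T : Set (Fin n), Integrable
      (fun S => tlim S * {S' : QuadConfig (univ : Set ℂ) | {i | Q i ∈ S'} = T}.indicator 1 S) μ) :
    Tendsto (fun k => ∫ ω, t k ω * g {i | Q i ∈ X k ω} ∂P) atTop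
      (𝓝 (∫ S, tlim S * g {i | Q i ∈ S} ∂μ)) := by
  have hlat : ∀ k, ∫ ω, t k ω * g {i | Q i ∈ X k ω} ∂P = ∑ T : Set (Fin n),
      g T * ∫ ω, t k ω * {S : QuadConfig (univ : Set ℂ) | {i | Q i ∈ S} = T}.indicator 1 (X k ω) ∂P :=
    fun k => by
      have heq : (fun ω => t k ω * g {i | Q i ∈ X k ω}) = fun ω => ∑ T : Set (Fin n),
          g T * (t k ω * {S : QuadConfig (univ : Set ℂ) | {i | Q i ∈ S} = T}.indicator 1 (X k ω)) :=
        funext fun ω => mul_apply_pattern_eq_sum Q g _ _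
      rw [heq, integral_finsetSum _ fun T _ => (hint k T).const_mul (g T)]
      exact Finset.sum_congr rfl fun T _ => integral_const_mul _ _
  have hlim : ∫ S, tlim S * g {i | Q i ∈ S} ∂μ = ∑ T : Set (Fin n),
      g T * ∫ S, tlim S * {S' : QuadConfig (univ : Set ℂ) | {i | Q i ∈ S'} = T}.indicator 1 S ∂μ := by
    have heq : (fun S : QuadConfig (univ : Set ℂ) => tlim S * g {i | Q i ∈ S}) = fun S =>
        ∑ T : Set (Fin n),
          g T * (tlim S * {S' : QuadConfig (univ : Set ℂ) | {i | Q i ∈ S'} = T}.indicator 1 S) :=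
      funext fun S => mul_apply_pattern_eq_sum Q g _ _
    rw [heq, integral_finsetSum _ fun T _ => (hintlim T).const_mul (g T)]
    exact Finset.sum_congr rfl fun T _ => integral_const_mul _ _
  rw [hlim]
  refine (tendsto_finsetSum _ fun T _ => (hatom T).const_mul (g T)).congr fun k => (hlat k).symm

/-! ### The limit passage for a non-negative test function -/

/-- **Core of the stub for `ψ ≥ 0`.**  Along a mesh sequence realising a subsequential limit `μ`
and along which `(ω_δ, ⟨μ^ε_δ(ω), ψ⟩)` converges jointly in law to `(S, ⟨M ε S, ψ⟩)` (tested on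
bounded continuous functions of `ℋ × ℝ`), with `sup_k E[⟨μ^ε_{δ_k}, ψ⟩²] ≤ C`:
`E[⟨μ^ε_{δ_k}, ψ⟩ g(pattern ω_{δ_k})] → ∫ ⟨M ε S, ψ⟩ g(pattern S) dμ` — the glue
`tendsto_integral_mul_indicator_of_tendsto_pair` on each pattern atom (a `μ`-continuity set by
Lemma 5.1), summed over the atoms. [folklore] -/
theorem tendsto_integral_integral_mul_apply_pattern_of_nonneg
    (μ : FiniteMeasure (QuadConfig (univ : Set ℂ)))
    (M : ℝ → QuadConfig (univ : Set ℂ) → Measure ℂ) (δs : ℕ → ℝ) (hpos : ∀ k, 0 < δs k)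
    (hμΛ : IsSubseqQuadLimit univ μ) {ε : ℝ} (hε : 0 < ε) (hM : Measurable (M ε))
    {ψ : ℂ → ℝ} (hψ : Continuous ψ) (hψc : HasCompactSupport ψ) (hψ0 : ∀ x, 0 ≤ ψ x)
    (hconv : ∀ F : BoundedContinuousFunction (QuadConfig (univ : Set ℂ) × ℝ) ℝ,
      Tendsto (fun k => ∫ ω, F (z2QuadConfig (univ : Set ℂ) (δs k) ω,
          ∫ x, ψ x ∂(z2PivotalMeasure ε (δs k) ω)) ∂(bondPercolation (zdGraph 2) half))
        atTop (𝓝 (∫ S, F (S, ∫ x, ψ x ∂(M ε S)) ∂(μ : Measure (QuadConfig (univ : Set ℂ))))))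
    {C : ℝ} (hC : ∀ k, ∫ ω, (∫ x, ψ x ∂(z2PivotalMeasure ε (δs k) ω)) ^ 2
      ∂(bondPercolation (zdGraph 2) half) ≤ C)
    {n : ℕ} (Q : Fin n → Quad (univ : Set ℂ)) (g : Set (Fin n) → ℝ) :
    Tendsto (fun k => ∫ ω, (∫ x, ψ x ∂(z2PivotalMeasure ε (δs k) ω)) *
        g {i | Q i ∈ z2QuadConfig (univ : Set ℂ) (δs k) ω} ∂(bondPercolation (zdGraph 2) half))
      atTop (𝓝 (∫ S, (∫ x, ψ x ∂(M ε S)) * g {i | Q i ∈ S}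
        ∂(μ : Measure (QuadConfig (univ : Set ℂ))))) ∧
    Integrable (fun S => ∫ x, ψ x ∂(M ε S)) (μ : Measure (QuadConfig (univ : Set ℂ))) := by
  haveI : TopologicalSpace.MetrizableSpace (QuadConfig (univ : Set ℂ)) :=
    (SchrammSmirnov2011_thm_1_4_holds univ isOpen_univ univ_nonempty).1.2.1
  haveI : IsProbabilityMeasure (bondPercolation (zdGraph 2) half) := by
    unfold bondPercolation; infer_instance
  have hX : ∀ k, Measurable (z2QuadConfig (univ : Set ℂ) (δs k)) := fun k =>
    measurable_z2QuadConfig isOpen_univ (hpos k)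
  have ht : ∀ k, Measurable fun ω => ∫ x, ψ x ∂(z2PivotalMeasure ε (δs k) ω) := fun k =>
    measurable_integral_z2PivotalMeasure hε (hpos k) hψ hψc
  have htlim : Measurable fun S => ∫ x, ψ x ∂(M ε S) :=
    measurable_integral_of_measurable_measure hM hψ.stronglyMeasurable
  have ht0 : ∀ k ω, 0 ≤ ∫ x, ψ x ∂(z2PivotalMeasure ε (δs k) ω) := fun k ω =>
    integral_nonneg hψ0
  have htlim0 : ∀ S, 0 ≤ ∫ x, ψ x ∂(M ε S) := fun S => integral_nonneg hψ0
  have hti : ∀ k, Integrable (fun ω => ∫ x, ψ x ∂(z2PivotalMeasure ε (δs k) ω))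
      (bondPercolation (zdGraph 2) half) := fun k =>
    integrable_integral_z2PivotalMeasure hε (hpos k) hψ hψc
  have hint : ∀ k, Integrable (fun ω => (∫ x, ψ x ∂(z2PivotalMeasure ε (δs k) ω)) ^ 2)
      (bondPercolation (zdGraph 2) half) := fun k =>
    integrable_sq_integral_z2PivotalMeasure hε (hpos k) hψ hψc
  have hone : ∀ (A : Set (QuadConfig (univ : Set ℂ))) (x : QuadConfig (univ : Set ℂ)),
      ‖A.indicator (1 : QuadConfig (univ : Set ℂ) → ℝ) x‖ ≤ 1 := fun A x =>
    (norm_indicator_le_norm_self _ _).trans_eq (by simp)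
  obtain ⟨-, -, htli⟩ := integrable_sq_of_tendsto_pair
    (X := fun k => z2QuadConfig (univ : Set ℂ) (δs k))
    (t := fun k ω => ∫ x, ψ x ∂(z2PivotalMeasure ε (δs k) ω))
    (tlim := fun S => ∫ x, ψ x ∂(M ε S)) htlim ht0 htlim0 hconv hint hC
  refine ⟨tendsto_integral_mul_apply_pattern Q g (fun T => ?_) (fun k T => ?_) (fun T => ?_), htli⟩
  · exact tendsto_integral_mul_indicator_of_tendsto_pair
      (X := fun k => z2QuadConfig (univ : Set ℂ) (δs k))
      (t := fun k ω => ∫ x, ψ x ∂(z2PivotalMeasure ε (δs k) ω))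
      (tlim := fun S => ∫ x, ψ x ∂(M ε S)) hX ht htlim ht0 htlim0 hconv hti hint hC
      (measurableSet_setOf_pattern_eq Q T) (measure_frontier_setOf_pattern_eq_zero hμΛ Q T)
  · exact (hti k).mul_bdd
      (((measurable_const.indicator (measurableSet_setOf_pattern_eq Q T)).comp
        (hX k)).aestronglyMeasurable) (ae_of_all _ fun ω => hone _ _)
  · exact htli.mul_bdd
      (measurable_const.indicator (measurableSet_setOf_pattern_eq Q T)).aestronglyMeasurable
      (ae_of_all _ fun S => hone _ _)

end Literature.Probability.Percolation

end
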